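import Summits.RiemannHypothesis.RiemannHypothesis.Theorems.SignConeConeMagnificationStubCara
import Summits.RiemannHypothesis.RiemannHypothesis.Theorems.SignConeExactConeRigidityContinuation

/-!
# Route SignCone, item `ExactConeRigidity` (stmt-RiemannHypothesis-16306): the Carathéodory description of
`κ`-slack cone weights on the half-plane `Re s > 1/2` — in particular the TIGHT majorant of EXACT weights

Archive 2001 fefr Thm A / swcm Thm A♭ (necessity halves).  Let `c ≥ 0`, `c 1 = 0`, be `κ`-slack feasible against
every Weil test, `-κ‖φ‖₂² ≤ Re (W_ar − P_c)(φ ⋆ φ̃)`, and unit-slack feasible (automatic for `κ ≤ 1`; for the exact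
cone of this item `κ = 0`).  Then the ONE holomorphic continuation `F` of `L_c(s) − 1/(s−1)` to `Re s > 1/2`
(`exists_continuation_halfPlane`, `SignConeExactConeRigidityContinuation.lean`) obeys

  `Re F(s) ≤ κ/2 + Re (1/s) + (1/2π) ∫ Re ψ(1/4 + iv/2) · (σ−½)/((σ−½)² + (t−v)²) dv − ½ log π`   (`Re s > 1/2`)

(`re_continuation_le_slack`).  The case `κ = 1` is 16303's registered `stub_cara` (landed independently as
`SignConeConeMagnification.stub_cara`, p133591, whose limit machinery — real bumps, approximate identity, dominated
convergence for the Poisson integrals — is reused here); the case `κ = 0` (`exactWeight_cara`) is the TIGHT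
description of the exact cone `K` of this item: for `c = Λ` it reads `Re ξ'/ξ ≥ 0` on `Re s > 1/2`, and on the
critical line the slack is exactly `0` — the form in which the exact chain's open core is ζ-free
(`SignConeExactConeRigidityCaraCore.lean`).

Proof: window identity (continuation file) + `κ`-slack Laplace positivity (`re_laplace_fakeForm_translate_nonneg`)
split as in `re_LSeries_mul_weilMellin_le`, then the shrinking-bump limit of `stub_cara` with coefficient `κ − log π`.
-/

noncomputable section

-- `Summit.RiemannHypothesis.RiemannHypothesis.…` repeats a namespace component by design (D-0017 layout).
set_option linter.dupNamespace false

open scoped BigOperators ComplexConjugate Real Topology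
open Complex MeasureTheory Set Filter

namespace Summit.RiemannHypothesis.RiemannHypothesis.Theorems.SignConeExactConeRigidity

open Literature.NumberTheory.LFunctions
open Summit.RiemannHypothesis.RiemannHypothesis.Theorems.SignCone
open Summit.RiemannHypothesis.RiemannHypothesis.Theorems.SignConeConeMagnification

variable {g : ℝ → ℂ} {c : ℕ → ℝ} {κ a : ℝ}

/-! ## The `κ`-slack Laplace inequality for a window -/

/-- **`κ`-slack Laplace inequality.**  Let `c ≥ 0` be `κ`-slack feasible and unit-slack feasible against every Weil
test, `g` a Weil test with `tsupport g ⊆ [-a, a]` (`a ≥ 0`), `G = g ⋆ g̃`, `M_G = weilMellin G`,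
`u(x) = P_c(G(· - x)) - e^{x/2} M_G(1)`.  For `Re z > 0`:
`Re ∫₀^∞ u(x) e^{-zx} dx ≤ Re (M_G(0)/(z + 1/2) + 𝓐_G(z) + κ 𝓖_G(z))`,
`𝓐_G(z) = ∫₀^∞ W_∞(G(·-x)) e^{-zx} dx`, `𝓖_G(z) = ∫₀^∞ G(-x) e^{-zx} dx` (`re_laplace_fakeForm_translate_nonneg` and
the split `a(x) = e^{-x/2} M_G(0) + W_∞(G(·-x)) - u(x) + κ G(-x)`, as in `re_LSeries_mul_weilMellin_le`). -/
theorem re_laplace_fakeSum_le_slack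
    (hUκ : ∀ φ : ℝ → ℂ, IsWeilTest φ →
      -(κ * ∫ t, ‖φ t‖ ^ 2) ≤
        (weilPolarTerm (weilConv φ (weilReflect φ)) + weilArchTerm (weilConv φ (weilReflect φ)) -
          ∑' n : ℕ, ((c n : ℝ) : ℂ) / (Real.sqrt n : ℂ) *
            (weilConv φ (weilReflect φ) (Real.log n) + weilConv φ (weilReflect φ) (-Real.log n))).re)
    (hU : ∀ φ : ℝ → ℂ, IsWeilTest φ →
      -(∫ t, ‖φ t‖ ^ 2) ≤
        (weilPolarTerm (weilConv φ (weilReflect φ)) + weilArchTerm (weilConv φ (weilReflect φ)) -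
          ∑' n : ℕ, ((c n : ℝ) : ℂ) / (Real.sqrt n : ℂ) *
            (weilConv φ (weilReflect φ) (Real.log n) + weilConv φ (weilReflect φ) (-Real.log n))).re)
    (hg : IsWeilTest g) (hsupp : tsupport g ⊆ Icc (-a) a) {z : ℂ} (hz0 : 0 < z.re) :
    (∫ x in Ioi (0 : ℝ), ((∑' n : ℕ, ((c n : ℝ) : ℂ) / (Real.sqrt n : ℂ) *
        (weilConv g (weilReflect g) (Real.log n - x) + weilConv g (weilReflect g) (-Real.log n - x))) -
          cexp ((x : ℂ) / 2) * weilMellin (weilConv g (weilReflect g)) 1) * cexp (-(z * x))).re ≤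
      (weilMellin (weilConv g (weilReflect g)) 0 / (z + 1 / 2) +
        (∫ x in Ioi (0 : ℝ), weilArchTerm (weilTranslate (weilConv g (weilReflect g)) x) * cexp (-(z * x))) +
        (κ : ℂ) * (∫ x in Ioi (0 : ℝ), weilConv g (weilReflect g) (-x) * cexp (-(z * x)))).re := by
  -- adapted from `re_LSeries_mul_weilMellin_le` (SignConeExactConeRigidityCaratheodoryDirichlet.lean)
  set G : ℝ → ℂ := weilConv g (weilReflect g) with hG
  have hGt : IsWeilTest G := hg.weilConv hg.weilReflect
  obtain ⟨M, hM⟩ := hGt.1.continuous.bounded_above_of_compact_support hGt.2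
  set f₀ : ℝ → ℂ := fun x => cexp (-((x : ℂ) / 2)) * weilMellin G 0 * cexp (-(z * x)) with hf₀
  set fA : ℝ → ℂ := fun x => weilArchTerm (weilTranslate G x) * cexp (-(z * x)) with hfA
  set u : ℝ → ℂ := fun x => (∑' n : ℕ, ((c n : ℝ) : ℂ) / (Real.sqrt n : ℂ) *
      (G (Real.log n - x) + G (-Real.log n - x))) - cexp ((x : ℂ) / 2) * weilMellin G 1 with hu
  set fu : ℝ → ℂ := fun x => u x * cexp (-(z * x)) with hfu
  set fG : ℝ → ℂ := fun x => G (-x) * cexp (-(z * x)) with hfG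
  have hi₀ : IntegrableOn f₀ (Ioi 0) := by
    have ha' : ((-(1 / 2) : ℂ) - z).re < 0 := by
      simp only [sub_re, neg_re, one_div]; norm_num; linarith
    have h : IntegrableOn (fun x : ℝ => cexp ((-(1 / 2) - z) * x) * weilMellin G 0) (Ioi 0) :=
      (integrableOn_exp_mul_complex_Ioi ha' 0).mul_const _
    refine h.congr_fun (fun x _ => ?_) measurableSet_Ioi
    show cexp ((-(1 / 2) - z) * x) * weilMellin G 0 = cexp (-((x : ℂ) / 2)) * weilMellin G 0 * cexp (-(z * x))
    rw [show ((-(1 / 2) : ℂ) - z) * x = -((x : ℂ) / 2) + -(z * x) by ring, Complex.exp_add]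
    ring
  have hiA : IntegrableOn fA (Ioi 0) := by
    refine integrableOn_mul_exp_of_bounded (continuous_weilArchTerm_weilTranslate hGt)
      (C := 1 / (2 * π) * (∫ t : ℝ, ‖weilMellin G (1 / 2 + t * I) *
        ((Complex.digamma (1 / 4 + t / 2 * I)).re : ℂ)‖) + M * Real.log π) (fun x _ => ?_) hz0
    refine (norm_weilArchTerm_weilTranslate_le hGt x).trans (add_le_add le_rfl ?_)
    exact mul_le_mul_of_nonneg_right (hM _) (Real.log_nonneg (by linarith [Real.pi_gt_three]))
  have hiu : IntegrableOn fu (Ioi 0) :=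
    integrableOn_mul_exp_of_bounded (@continuous_fakeSum_translate_sub g a hg hsupp c)
      (fun x hx => @norm_fakeSum_translate_sub_le g c hU hg M hM x hx) hz0
  have hiG : IntegrableOn fG (Ioi 0) :=
    integrableOn_mul_exp_of_bounded (hGt.1.continuous.comp continuous_neg) (C := M) (fun x _ => hM _) hz0
  have hdecomp : ∀ x : ℝ,
      (weilPolarTerm (weilTranslate G x) + weilArchTerm (weilTranslate G x) -
          (∑' n : ℕ, ((c n : ℝ) : ℂ) / (Real.sqrt n : ℂ) *
            (weilTranslate G x (Real.log n) + weilTranslate G x (-Real.log n))) +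
        (κ : ℂ) * weilTranslate G x 0) * cexp (-(z * x)) =
      f₀ x + fA x - fu x + (κ : ℂ) * fG x := by
    intro x
    simp only [hf₀, hfA, hfu, hfG, hu, weilPolarTerm_weilTranslate, weilTranslate, zero_sub]
    ring
  have hL := re_laplace_fakeForm_translate_nonneg hUκ hg hz0
  have hcongr : (∫ x in Ioi (0 : ℝ),
      (weilPolarTerm (weilTranslate G x) + weilArchTerm (weilTranslate G x) -
          (∑' n : ℕ, ((c n : ℝ) : ℂ) / (Real.sqrt n : ℂ) *
            (weilTranslate G x (Real.log n) + weilTranslate G x (-Real.log n))) +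
        (κ : ℂ) * weilTranslate G x 0) * cexp (-(z * x))) =
      ∫ x in Ioi (0 : ℝ), (f₀ x + fA x - fu x + (κ : ℂ) * fG x) :=
    integral_congr_ae ((ae_restrict_iff' measurableSet_Ioi).2 (Eventually.of_forall fun x _ => hdecomp x))
  have hs1 : (∫ x in Ioi (0 : ℝ), (f₀ x + fA x - fu x + (κ : ℂ) * fG x)) =
      (∫ x in Ioi (0 : ℝ), (f₀ x + fA x - fu x)) + ∫ x in Ioi (0 : ℝ), (κ : ℂ) * fG x :=
    integral_add ((hi₀.add hiA).sub hiu) (hiG.const_mul _)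
  have hs2 : (∫ x in Ioi (0 : ℝ), (f₀ x + fA x - fu x)) =
      (∫ x in Ioi (0 : ℝ), (f₀ x + fA x)) - ∫ x in Ioi (0 : ℝ), fu x :=
    integral_sub (hi₀.add hiA) hiu
  have hs3 : (∫ x in Ioi (0 : ℝ), (f₀ x + fA x)) = (∫ x in Ioi (0 : ℝ), f₀ x) + ∫ x in Ioi (0 : ℝ), fA x :=
    integral_add hi₀ hiA
  have hs4 : (∫ x in Ioi (0 : ℝ), (κ : ℂ) * fG x) = (κ : ℂ) * ∫ x in Ioi (0 : ℝ), fG x := integral_const_mul _ _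
  have hI₀ : (∫ x in Ioi (0 : ℝ), f₀ x) = weilMellin G 0 / (z + 1 / 2) := by
    have e : f₀ = fun x : ℝ => weilMellin G 0 * (cexp (-((x : ℂ) / 2)) * cexp (-(z * x))) := by
      funext x; simp only [hf₀]; ring
    rw [e, integral_const_mul, integral_exp_neg_half_laplace (by linarith)]
    ring
  rw [hcongr, hs1, hs2, hs3, hs4, hI₀] at hL
  simp only [Complex.sub_re, Complex.add_re] at hL ⊢
  linarith

/-! ## The Carathéodory description on the half-plane -/

/-- **Carathéodory description of `κ`-slack cone weights on `Re s > 1/2`** (archive 2001 fefr Thm A / swcm Thm A♭,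
necessity).  Let `c ≥ 0`, `c 1 = 0`, be `κ`-slack feasible and unit-slack feasible against every Weil test.  Then
there is ONE `F`, holomorphic on `{Re s > 1/2}`, with `F = L_c − 1/(s−1)` on `Re s > 1`, such that for every
`Re s > 1/2`:
`Re F(s) ≤ κ/2 + Re (1/s) + (1/2π) ∫ Re ψ(1/4+iv/2)·(σ−½)/((σ−½)²+(t−v)²) dv − ½ log π`. -/
theorem re_continuation_le_slack
    (hUκ : ∀ φ : ℝ → ℂ, IsWeilTest φ →
      -(κ * ∫ t, ‖φ t‖ ^ 2) ≤
        (weilPolarTerm (weilConv φ (weilReflect φ)) + weilArchTerm (weilConv φ (weilReflect φ)) -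
          ∑' n : ℕ, ((c n : ℝ) : ℂ) / (Real.sqrt n : ℂ) *
            (weilConv φ (weilReflect φ) (Real.log n) + weilConv φ (weilReflect φ) (-Real.log n))).re)
    (hU : ∀ φ : ℝ → ℂ, IsWeilTest φ →
      -(∫ t, ‖φ t‖ ^ 2) ≤
        (weilPolarTerm (weilConv φ (weilReflect φ)) + weilArchTerm (weilConv φ (weilReflect φ)) -
          ∑' n : ℕ, ((c n : ℝ) : ℂ) / (Real.sqrt n : ℂ) *
            (weilConv φ (weilReflect φ) (Real.log n) + weilConv φ (weilReflect φ) (-Real.log n))).re)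
    (hc : ∀ n, 0 ≤ c n) (hc1 : c 1 = 0) :
    ∃ F : ℂ → ℂ, DifferentiableOn ℂ F {s : ℂ | 1 / 2 < s.re} ∧
      (∀ s : ℂ, 1 < s.re → F s = LSeries (fun n => ((c n : ℝ) : ℂ)) s - 1 / (s - 1)) ∧
      ∀ s : ℂ, 1 / 2 < s.re →
        (F s).re ≤ κ / 2 + (1 / s).re +
          1 / (2 * Real.pi) * (∫ v : ℝ, (Complex.digamma (1 / 4 + v / 2 * Complex.I)).re *
            ((s.re - 1 / 2) / ((s.re - 1 / 2) ^ 2 + (s.im - v) ^ 2))) - Real.log Real.pi / 2 := by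
  -- adapted from `SignConeConeMagnification.stub_cara` (p133591): same bumps, same limits, coefficient `κ - log π`
  obtain ⟨F, hFd, hFL, hwin⟩ := exists_continuation_halfPlane hU hc
  refine ⟨F, hFd, hFL, fun s hs => ?_⟩
  -- write `s = z + 1/2`, `Re z > 0`
  obtain ⟨z, rfl⟩ : ∃ z : ℂ, s = z + 1 / 2 := ⟨s - 1 / 2, by ring⟩
  have hz0 : 0 < z.re := by
    have : (z + 1 / 2).re = z.re + 1 / 2 := by simp
    rw [this] at hs; linarith
  have hzre : (z + 1 / 2).re - 1 / 2 = z.re := by simp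
  have hzim : (z + 1 / 2).im = z.im := by simp
  have e3 : z + 1 / 2 - 1 / 2 = z := by ring
  rw [hzre, hzim]
  -- the shrinking real bumps `g_k` of radius `ε_k = 1/(4(k+1)) ≤ 1/4`
  set ε : ℕ → ℝ := fun k => 1 / (4 * ((k : ℝ) + 1)) with hε
  have hε0 : ∀ k, 0 < ε k := fun k => by positivity
  have hε4 : ∀ k, ε k ≤ 1 / 4 := fun k => by
    show 1 / (4 * ((k : ℝ) + 1)) ≤ 1 / 4
    exact one_div_le_one_div_of_le (by norm_num) (by nlinarith [(Nat.cast_nonneg k : (0 : ℝ) ≤ k)])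
  have hεt : Tendsto (fun k => 2 * ε k) atTop (𝓝 0) := by
    have h := (tendsto_one_div_add_atTop_nhds_zero_nat (𝕜 := ℝ)).const_mul (1 / 2)
    rw [mul_zero] at h
    refine h.congr fun k => ?_
    show 1 / 2 * (1 / ((k : ℝ) + 1)) = 2 * (1 / (4 * ((k : ℝ) + 1)))
    field_simp
    norm_num
  set b : ℕ → ContDiffBump (0 : ℝ) := fun k => ⟨ε k / 2, ε k, half_pos (hε0 k), half_lt_self (hε0 k)⟩
    with hb
  obtain ⟨G, hG⟩ : ∃ G : ℕ → ℝ → ℂ, ∀ k,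
      weilConv (fun u => ((b k u : ℝ) : ℂ)) (weilReflect fun u => ((b k u : ℝ) : ℂ)) = G k := ⟨_, fun k => rfl⟩
  have hbk := fun k => weilConv_weilReflect_bump (b k)
  simp only [hG] at hbk
  have hgW : ∀ k, IsWeilTest (fun u => ((b k u : ℝ) : ℂ)) := fun k => (hbk k).1
  have hGt : ∀ k, IsWeilTest (G k) := fun k => hG k ▸ (hgW k).weilConv (hgW k).weilReflect
  have hsupp : ∀ k, tsupport (fun u => ((b k u : ℝ) : ℂ)) ⊆ Icc (-ε k) (ε k) := fun k => (hbk k).2.1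
  have hGn : ∀ k t, G k t = ((‖G k t‖ : ℝ) : ℂ) := fun k => (hbk k).2.2.1
  have hGδ : ∀ k t, 2 * ε k < |t| → G k t = 0 := fun k => (hbk k).2.2.2.1
  have hm0' : ∀ k, 0 < ∫ t, ‖G k t‖ := fun k => (hbk k).2.2.2.2
  have hGc : ∀ k, Continuous (G k) := fun k => (hGt k).1.continuous
  obtain ⟨m, hm⟩ : ∃ m : ℕ → ℝ, ∀ k, (∫ t, ‖G k t‖) = m k := ⟨_, fun k => rfl⟩
  have hm0 : ∀ k, 0 < m k := fun k => hm k ▸ hm0' k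
  -- the approximate identity for the family `G_k`
  have hAI : ∀ φ : ℝ → ℂ, Continuous φ →
      Tendsto (fun k => (∫ u, G k u * φ u) / (m k : ℂ)) atTop (𝓝 (φ 0)) := by
    intro φ hφ
    have h := tendsto_integral_mul_div hεt hGc hGδ hGn hm0' hφ
    simp only [hm] at h
    exact h
  -- (a) `M_{G_k}(w)/m_k → 1`
  have hTM : ∀ w : ℂ, Tendsto (fun k => weilMellin (G k) w / (m k : ℂ)) atTop (𝓝 1) := by
    intro w
    have h := hAI (fun u : ℝ => cexp ((w - 1 / 2) * u)) (by fun_prop)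
    simpa [weilMellin] using h
  -- (b) `dslope M_{G_k} 1 s / m_k → 0`
  have hTD : Tendsto (fun k => dslope (weilMellin (G k)) 1 (z + 1 / 2) / (m k : ℂ)) atTop (𝓝 0) := by
    set φ : ℝ → ℂ := fun u => if z + 1 / 2 = 1 then (u : ℂ) * cexp ((1 - 1 / 2) * u)
      else (cexp ((z + 1 / 2 - 1 / 2) * u) - cexp ((1 - 1 / 2) * u)) / (z + 1 / 2 - 1) with hφ
    have hφc : Continuous φ := by simp only [hφ]; split_ifs <;> fun_prop
    have hφ0 : φ 0 = 0 := by simp [hφ]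
    have hD : ∀ k, dslope (weilMellin (G k)) 1 (z + 1 / 2) = ∫ u, G k u * φ u := by
      intro k
      simp only [hφ]
      split_ifs with h1
      · rw [h1, dslope_same, (hasDerivAt_weilMellin (hGc k) (hGt k).2 1).deriv]
      · rw [dslope_of_ne _ h1, slope_def_field]
        simp only [weilMellin]
        rw [← integral_sub (integrable_weilIntegrand (hGc k) (hGt k).2 (z + 1 / 2))
          (integrable_weilIntegrand (hGc k) (hGt k).2 1), ← integral_div]
        congr 1 with u
        ring
    have h := hAI φ hφc
    rw [hφ0] at h
    refine h.congr fun k => ?_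
    rw [hD k]
  -- (c) `𝓖_{G_k}(z)/m_k → 1/2` (evenness of `G_k`)
  have hTG : Tendsto (fun k => (∫ x in Ioi (0 : ℝ), G k (-x) * cexp (-(z * x))) / (m k : ℂ)) atTop
      (𝓝 (1 / 2)) := by
    have heven : ∀ k u, G k (-u) = G k u := fun k u => by
      have h := conj_weilConv_weilReflect_neg (fun u => ((b k u : ℝ) : ℂ)) u
      rw [hG k, hGn k (-u), Complex.conj_ofReal] at h
      rw [hGn k (-u)]
      exact h
    have hψc : Continuous fun u : ℝ => cexp (-(z * ((|u| : ℝ) : ℂ))) := by fun_prop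
    have hhalf : ∀ k, (∫ x in Ioi (0 : ℝ), G k (-x) * cexp (-(z * x))) =
        (1 / 2 : ℂ) * ∫ u, G k u * cexp (-(z * ((|u| : ℝ) : ℂ))) := by
      intro k
      have hint : Integrable (fun u : ℝ => G k u * cexp (-(z * ((|u| : ℝ) : ℂ)))) :=
        ((hGc k).mul hψc).integrable_of_hasCompactSupport (hGt k).2.mul_right
      rw [← intervalIntegral.integral_Iic_add_Ioi (b := 0) hint.integrableOn hint.integrableOn]
      have h1 : (∫ u in Ioi (0 : ℝ), G k u * cexp (-(z * ((|u| : ℝ) : ℂ)))) =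
          ∫ x in Ioi (0 : ℝ), G k (-x) * cexp (-(z * x)) :=
        setIntegral_congr_fun measurableSet_Ioi fun u (hu : 0 < u) => by
          simp only [abs_of_pos hu, heven]
      have h2 := integral_comp_neg_Ioi 0 (fun u : ℝ => G k u * cexp (-(z * ((|u| : ℝ) : ℂ))))
      simp only [neg_zero, abs_neg] at h2
      have h3 : (∫ x in Ioi (0 : ℝ), G k (-x) * cexp (-(z * ((|x| : ℝ) : ℂ)))) =
          ∫ x in Ioi (0 : ℝ), G k (-x) * cexp (-(z * x)) :=
        setIntegral_congr_fun measurableSet_Ioi fun u (hu : 0 < u) => by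
          simp only [abs_of_pos hu]
      rw [← h2, h1, h3]
      ring
    have h := (hAI _ hψc).const_mul (1 / 2 : ℂ)
    simp only [abs_zero, ofReal_zero, mul_zero, neg_zero, Complex.exp_zero, mul_one] at h
    refine h.congr fun k => ?_
    rw [hhalf k, mul_div_assoc]
  -- (d) the archimedean piece: `0 ≤ r_k ≤ 1`, `r_k → 1`, dominated convergence
  have hle : ∀ k (v : ℝ), ‖weilMellin (fun u => ((b k u : ℝ) : ℂ)) (1 / 2 + v * I)‖ ^ 2 ≤ m k := by
    intro k v
    have h1 := weilMellin_weilConv_weilReflect_half (hgW k) v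
    rw [hG k] at h1
    have h2 : ‖weilMellin (G k) (1 / 2 + v * I)‖ ≤ m k := by
      rw [weilMellin, ← hm k]
      refine (norm_integral_le_integral_norm _).trans (le_of_eq ?_)
      congr 1 with u
      rw [norm_mul, Complex.norm_exp]
      simp [mul_re]
    rw [h1, Complex.norm_real, Real.norm_of_nonneg (by positivity)] at h2
    exact h2
  have hlim : ∀ v : ℝ,
      Tendsto (fun k => ‖weilMellin (fun u => ((b k u : ℝ) : ℂ)) (1 / 2 + v * I)‖ ^ 2 / m k) atTop (𝓝 1) := by
    intro v
    have h := (Complex.continuous_re.tendsto _).comp (hTM (1 / 2 + v * I))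
    simp only [Complex.one_re] at h
    refine h.congr fun k => ?_
    simp only [Function.comp_apply]
    rw [← hG k, weilMellin_weilConv_weilReflect_half (hgW k) v, Complex.div_ofReal_re, Complex.ofReal_re]
  have hTA := tendsto_integral_reDigamma_poisson hgW hm0 hle hlim hz0 z.im
  -- the scaled `κ`-window inequality for each `k`
  have hineq : ∀ k,
      (F (z + 1 / 2) * (weilMellin (G k) (z + 1 / 2) / (m k : ℂ))).re +
          (dslope (weilMellin (G k)) 1 (z + 1 / 2) / (m k : ℂ)).re ≤
        (weilMellin (G k) 0 / (m k : ℂ) / (z + 1 / 2)).re +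
          1 / (2 * Real.pi) * (∫ v : ℝ, ‖weilMellin (fun u => ((b k u : ℝ) : ℂ)) (1 / 2 + v * I)‖ ^ 2 / m k *
            (Complex.digamma (1 / 4 + v / 2 * I)).re * (z.re / (z.re ^ 2 + (z.im - v) ^ 2))) +
          (κ - Real.log Real.pi) * ((∫ x in Ioi (0 : ℝ), G k (-x) * cexp (-(z * x))) / (m k : ℂ)).re := by
    intro k
    -- window identity at `s = z + 1/2` (no finite correction for radius `≤ 1/4`) and the `κ`-Laplace inequality
    have hW := hwin (fun u => ((b k u : ℝ) : ℂ)) (ε k) (hgW k) (hε0 k).le (hsupp k) (z + 1 / 2) hs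
    rw [e3] at hW
    rw [finCorrection_eq_zero hc1 (hε0 k).le (hε4 k), sub_zero] at hW
    have hLap := re_laplace_fakeSum_le_slack hUκ hU (hgW k) (hsupp k) hz0
    have hA := re_laplace_weilArchTerm_weilTranslate (hgW k) hz0
    simp only [hG k] at hW hLap hA
    rw [hW] at hLap
    simp only [Complex.add_re, Complex.re_ofReal_mul] at hLap
    rw [hA] at hLap
    have hmk := hm0 k
    have e1 : (F (z + 1 / 2) * (weilMellin (G k) (z + 1 / 2) / (m k : ℂ))).re =
        (F (z + 1 / 2) * weilMellin (G k) (z + 1 / 2)).re / m k := by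
      rw [← mul_div_assoc, Complex.div_ofReal_re]
    have e2 : (weilMellin (G k) 0 / (m k : ℂ) / (z + 1 / 2)).re = (weilMellin (G k) 0 / (z + 1 / 2)).re / m k := by
      rw [div_right_comm, Complex.div_ofReal_re]
    have e4 : (∫ v : ℝ, ‖weilMellin (fun u => ((b k u : ℝ) : ℂ)) (1 / 2 + v * I)‖ ^ 2 / m k *
            (Complex.digamma (1 / 4 + v / 2 * I)).re * (z.re / (z.re ^ 2 + (z.im - v) ^ 2))) =
        (∫ v : ℝ, ‖weilMellin (fun u => ((b k u : ℝ) : ℂ)) (1 / 2 + v * I)‖ ^ 2 *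
            (Complex.digamma (1 / 4 + v / 2 * I)).re * (z.re / (z.re ^ 2 + (z.im - v) ^ 2))) / m k := by
      rw [← integral_div]
      congr 1 with v
      ring
    rw [e1, Complex.div_ofReal_re, e2, e4, Complex.div_ofReal_re]
    have h := div_le_div_of_nonneg_right hLap hmk.le
    refine (le_of_eq ?_).trans (h.trans (le_of_eq ?_))
    · ring
    · ring
  -- pass to the limit `k → ∞`
  have hre : ∀ {u : ℕ → ℂ} {w : ℂ}, Tendsto u atTop (𝓝 w) → Tendsto (fun k => (u k).re) atTop (𝓝 w.re) :=
    fun h => (Complex.continuous_re.tendsto _).comp h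
  have hL : Tendsto (fun k => (F (z + 1 / 2) * (weilMellin (G k) (z + 1 / 2) / (m k : ℂ))).re +
      (dslope (weilMellin (G k)) 1 (z + 1 / 2) / (m k : ℂ)).re) atTop (𝓝 ((F (z + 1 / 2) * 1).re + (0 : ℂ).re)) :=
    (hre (tendsto_const_nhds.mul (hTM (z + 1 / 2)))).add (hre hTD)
  have hRl : Tendsto (fun k => (weilMellin (G k) 0 / (m k : ℂ) / (z + 1 / 2)).re +
        1 / (2 * Real.pi) * (∫ v : ℝ, ‖weilMellin (fun u => ((b k u : ℝ) : ℂ)) (1 / 2 + v * I)‖ ^ 2 / m k *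
          (Complex.digamma (1 / 4 + v / 2 * I)).re * (z.re / (z.re ^ 2 + (z.im - v) ^ 2))) +
        (κ - Real.log Real.pi) * ((∫ x in Ioi (0 : ℝ), G k (-x) * cexp (-(z * x))) / (m k : ℂ)).re) atTop
      (𝓝 ((1 / (z + 1 / 2)).re + 1 / (2 * Real.pi) * (∫ v : ℝ, (Complex.digamma (1 / 4 + v / 2 * I)).re *
          (z.re / (z.re ^ 2 + (z.im - v) ^ 2))) + (κ - Real.log Real.pi) * (1 / 2 : ℂ).re)) :=
    ((hre ((hTM 0).div_const (z + 1 / 2))).add (hTA.const_mul _)).add ((hre hTG).const_mul _)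
  have hfin := le_of_tendsto_of_tendsto' hL hRl hineq
  simp only [mul_one, Complex.zero_re, add_zero] at hfin
  have h12 : (1 / 2 : ℂ).re = 1 / 2 := by simp
  rw [h12] at hfin
  linarith

/-- **The TIGHT Carathéodory description of EXACT-cone weights** (`κ = 0`; archive 2001 fefr Thm A, necessity):
if `c ≥ 0`, `c 1 = 0`, is exact-feasible against every Weil test (the weights produced from this item's hypothesis
by `exists_exactWeight_of_exactSignCone`), then ONE holomorphic `F` on `Re s > 1/2` continues `L_c − 1/(s−1)` and
`Re F(s) ≤ Re (1/s) + (1/2π) ∫ Re ψ(1/4+iv/2)·(σ−½)/((σ−½)²+(t−v)²) dv − ½ log π`  (`Re s > 1/2`) —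
with NO additive slack.  (For `c = Λ` the right side minus the left side is `Re ξ'/ξ(s)`.) -/
theorem exactWeight_cara
    (hU0 : ∀ φ : ℝ → ℂ, IsWeilTest φ →
      0 ≤ (weilPolarTerm (weilConv φ (weilReflect φ)) + weilArchTerm (weilConv φ (weilReflect φ)) -
          ∑' n : ℕ, ((c n : ℝ) : ℂ) / (Real.sqrt n : ℂ) *
            (weilConv φ (weilReflect φ) (Real.log n) + weilConv φ (weilReflect φ) (-Real.log n))).re)
    (hc : ∀ n, 0 ≤ c n) (hc1 : c 1 = 0) :
    ∃ F : ℂ → ℂ, DifferentiableOn ℂ F {s : ℂ | 1 / 2 < s.re} ∧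
      (∀ s : ℂ, 1 < s.re → F s = LSeries (fun n => ((c n : ℝ) : ℂ)) s - 1 / (s - 1)) ∧
      ∀ s : ℂ, 1 / 2 < s.re →
        (F s).re ≤ (1 / s).re +
          1 / (2 * Real.pi) * (∫ v : ℝ, (Complex.digamma (1 / 4 + v / 2 * Complex.I)).re *
            ((s.re - 1 / 2) / ((s.re - 1 / 2) ^ 2 + (s.im - v) ^ 2))) - Real.log Real.pi / 2 := by
  have h2 : ∀ φ : ℝ → ℂ, 0 ≤ ∫ t, ‖φ t‖ ^ 2 := fun φ => integral_nonneg fun t => by positivity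
  obtain ⟨F, hFd, hFL, hle⟩ := re_continuation_le_slack (κ := 0)
    (fun φ hφ => by rw [zero_mul, neg_zero]; exact hU0 φ hφ) (fun φ hφ => by linarith [hU0 φ hφ, h2 φ]) hc hc1
  refine ⟨F, hFd, hFL, fun s hs => ?_⟩
  have h := hle s hs
  simp only [zero_div, zero_add] at h
  exact h

/-- **The unit-slack case `κ = 1`**, in the hypotheses-free-of-continuation form: for `c ≥ 0`, `c 1 = 0`, with unit
slack against every Weil test, `Re F(s) ≤ 1/2 + Re (1/s) + 𝒜(s) − ½ log π` on `Re s > 1/2` for the glued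
continuation `F` (cf. 16303's registered `stub_cara`, which assumes in addition summability, local continuations and
the Laplace positivity — all consequences of unit slack). -/
theorem unitSlackWeight_cara
    (hU : ∀ φ : ℝ → ℂ, IsWeilTest φ →
      -(∫ t, ‖φ t‖ ^ 2) ≤
        (weilPolarTerm (weilConv φ (weilReflect φ)) + weilArchTerm (weilConv φ (weilReflect φ)) -
          ∑' n : ℕ, ((c n : ℝ) : ℂ) / (Real.sqrt n : ℂ) *
            (weilConv φ (weilReflect φ) (Real.log n) + weilConv φ (weilReflect φ) (-Real.log n))).re)
    (hc : ∀ n, 0 ≤ c n) (hc1 : c 1 = 0) :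
    ∃ F : ℂ → ℂ, DifferentiableOn ℂ F {s : ℂ | 1 / 2 < s.re} ∧
      (∀ s : ℂ, 1 < s.re → F s = LSeries (fun n => ((c n : ℝ) : ℂ)) s - 1 / (s - 1)) ∧
      ∀ s : ℂ, 1 / 2 < s.re →
        (F s).re ≤ 1 / 2 + (1 / s).re +
          1 / (2 * Real.pi) * (∫ v : ℝ, (Complex.digamma (1 / 4 + v / 2 * Complex.I)).re *
            ((s.re - 1 / 2) / ((s.re - 1 / 2) ^ 2 + (s.im - v) ^ 2))) - Real.log Real.pi / 2 := by
  exact re_continuation_le_slack (κ := 1) (fun φ hφ => by rw [one_mul]; exact hU φ hφ) hU hc hc1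

end Summit.RiemannHypothesis.RiemannHypothesis.Theorems.SignConeExactConeRigidity

end
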